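import Summits.AtomisticToContinuum.Crystallization.Theorems.ChartedPlanarOrderTubeChannelsC

/-!
# The REFERENCE-CENTRED currency of the 7c′ chain: 7c‴ `TubeConvexRef` ⟸ its convexity half ⟸ CH-Ref ⟸ leaves (decomp-a2c lens-3 g24, task (y))

(s) `…TubeConvex` typed, next to the W′ slot of record `TubeConvexW' Λ₁ ρ₀`, the reference-centred form 7c‴ `TubeConvexRef Λ₁ ρ₀` — census
objects = the UNIFORMLY CLEAN zero-gap-stress stacked references `w'` (binder list: `IsStacked a b w'`, `LinearIndependent ℝ ![a, b]`,
`‖a‖, ‖b‖ ≤ Λ₁`, `IsSep δ`, `IsCleanW`, `∀ m, gapStress a b m (incr w') = 0`, `UniformlyClean (Layered a b w')`) — together with the F2 feeder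
`tubeUniquenessRef_of_tubeConvexRef` and lens-4's RDEF cone `…_pinning_convexRef` (slot `hRef := BasalReferenceCW Λ₁ ρ₁`, the reference WITH
its `IsCleanW` conjunct); (t) `…TubeConvexSplit` typed the halves `TubeLipschitzRef` / `TubeConvexityRef` with `tubeConvexRef_of_split`.
(u)/(v)/(w)/(x) then ran the W′ currency only.  This file runs the SAME chain in the Ref currency — the one a certifier can evaluate: the tube
centres `incr w' m` of a uniformly clean zero-gap-stress stacked reference are REGISTRY increments (hollow-site offset, equilibrium spacing), so
every certificate below is an explicit planar lattice sum on a ball round a KNOWN centre (this closes the «centre location» point left open in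
the W′ currency, where the centres `incr w m` of the actual configuration are only known a posteriori).

* §1 7c‴ᴾ `PairModulusRef Λ₁ ρ` [ANALYTIC] and ★ `pairModulusRef_of_le : Λ₁ ≤ 17/16 → ρ < 19/50 → PairModulusRef Λ₁ ρ` ((v)
  `pairModulus_of_cleanP_stacked`, `IsCleanW = IsCleanP (103/100)`); `tubeLipschitzRef_of_pairModulusRef`, ★ `tubeLipschitzRef_of_le`;
  ★★ `tubeConvexRef_of_convexityRef : Λ₁ ≤ 17/16 → ρ < 19/50 → TubeConvexityRef Λ₁ ρ → TubeConvexRef Λ₁ ρ` (7c‴ ⟸ ITS CONVEXITY HALF).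
* §2 CH-Ref `TubeChannelsRef Λ₁ ρ` [CERT · census objects = references] and the glue `tubeConvexityRef_of_pairModulus_channels`,
  ★ `tubeConvexityRef_of_channels`, `tubeConvexRef_of_channels`, OF RECORD `tubeConvexRef_record_of_channels :
  TubeChannelsRef (17/16) (1/40) → TubeConvexRef (17/16) (1/40)`.
* §3 LEAVES in the Ref currency with explicit constant slots: `AdjacentChannelRef Λ₁ ρ λ_T λ_N` [ONE cert], `FarChannelBelowRef Λ₁ ρ μ_T μ_N s₀`
  [`s₀ − 2` certs], `PairModulusTailRef Λ₁ ρ s₀ B₂` [analytic tail]; glue `tubeChannelsRef_of_leaves`, `tubeConvexRef_record_of_leaves`.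
* §4 cones: `rdef_of_grossU_shape_gluing_pinning_convexityRef` (slot 7 = 7c‴ᶜ `TubeConvexityRef Λ₁ ρ₀`, `hRef : BasalReferenceCW Λ₁ ρ₁`),
  `rdef_of_grossU_shape_gluing_pinning_channelsRef` (slot 7 = CH-Ref) and their `_record` instances at `(2, 17/16; 1/40, 3/16)`.

All proofs are binder plumbing over (s)(t)(u)(v)(x); sorry-free, standard axioms; no instances, no notation.
-/

noncomputable section

namespace Summit.AtomisticToContinuum.Crystallization.Theorems.ChartedPlanarOrderTubeChannelsRef

open Finset
open scoped RealInnerProductSpace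
open Summit.AtomisticToContinuum.Crystallization.Theorems.ChartedPlanarOrderChunkFloor (E3)
open Summit.AtomisticToContinuum.Crystallization.Theorems.ChartedPlanarOrderProfileSlavingLJ (IsStacked gapStress incr tube)
open Summit.AtomisticToContinuum.Crystallization.Theorems.ChartedPlanarOrderTubeMonotoneSplit (IsPairModulus)
open Summit.AtomisticToContinuum.Crystallization.Theorems.ChartedPlanarOrderDensityDichotomy (μS IsSep)
open Summit.AtomisticToContinuum.Crystallization.Theorems.ChartedPlanarOrderDoorLayered (Layered)
open Summit.AtomisticToContinuum.Crystallization.Theorems.OverbindingBudgetPeriodicCleanOrStrained (UniformlyClean)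
open Summit.AtomisticToContinuum.Crystallization.Theorems.OverbindingBudgetScaleWidening (IsCleanW)
open Summit.AtomisticToContinuum.Crystallization.Theorems.ChartedPlanarOrderTubeConvex (TubeConvexRef)
open Summit.AtomisticToContinuum.Crystallization.Theorems.ChartedPlanarOrderTubeConvexSplit (TubeConvexityData TubeLipschitzRef
  TubeConvexityRef tubeConvexRef_of_split)
open Summit.AtomisticToContinuum.Crystallization.Theorems.ChartedPlanarOrderStraddleLipschitz (summable_famOf_tube
  tubeLipschitzData_of_pairModulus)
open Summit.AtomisticToContinuum.Crystallization.Theorems.ChartedPlanarOrderPairModulus (pairModulus_of_cleanP_stacked)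
open Summit.AtomisticToContinuum.Crystallization.Theorems.ChartedPlanarOrderTubeChannels (IsAdjacentChannelMono IsFarChannelModulusBelow
  TubeChannelData tubeConvexityData_of_channels tubeChannelData_of_certs exists_unit_normal)

/-! ## §1 The Lipschitz half in the Ref currency (unconditional in range) and 7c‴ ⟸ its convexity half -/

/-- 7c‴ᴾ · **`PairModulusRef Λ₁ ρ`** — span moduli with summable third moment round every uniformly clean zero-gap-stress stacked reference
(`TubeConvexRef`'s binder list verbatim). [ANALYTIC · PROVED in range below] -/
def PairModulusRef (Λ₁ ρ : ℝ) : Prop :=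
  ∀ δ : ℝ, 0 < δ → ∀ (a b : E3) (w' : ℤ → E3), IsStacked a b w' → LinearIndependent ℝ ![a, b] → ‖a‖ ≤ Λ₁ → ‖b‖ ≤ Λ₁ →
    IsSep δ (Layered a b w') → IsCleanW (μS (Layered a b w')) → (∀ m : ℤ, gapStress a b m (incr w') = 0) →
    UniformlyClean (Layered a b w') →
    ∃ τ : ℕ → ℝ, (∀ s, 0 ≤ τ s) ∧ Summable (fun s : ℕ => (s : ℝ) ^ 3 * τ s) ∧ IsPairModulus a b w' ρ τ

/-- ★ 7c‴ᴾ HOLDS for `Λ₁ ≤ 17/16`, `ρ < 19/50` ((v) `pairModulus_of_cleanP_stacked`; `IsCleanW = IsCleanP (103/100)`, `103/100 ≤ 8/7`). -/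
theorem pairModulusRef_of_le {Λ₁ ρ : ℝ} (hΛ : Λ₁ ≤ 17 / 16) (hρ : ρ < 19 / 50) : PairModulusRef Λ₁ ρ :=
  fun _ hδ _ _ _ hst _ ha hb hs hc _ _ =>
    pairModulus_of_cleanP_stacked (aHi := 103 / 100) (by norm_num) hρ hδ hs hc hst (ha.trans hΛ) (hb.trans hΛ)

/-- 7c‴ᴸ ⟸ 7c‴ᴾ. -/
theorem tubeLipschitzRef_of_pairModulusRef {Λ₁ ρ : ℝ} (h : PairModulusRef Λ₁ ρ) : TubeLipschitzRef Λ₁ ρ := by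
  intro δ hδ a b w' hst hab ha hb hs hc hz hUC
  obtain ⟨τ, hτ0, hτ3, hP⟩ := h δ hδ a b w' hst hab ha hb hs hc hz hUC
  exact tubeLipschitzData_of_pairModulus hδ hab hst hs hτ0 hτ3 hP

/-- ★ 7c‴ᴸ HOLDS for `Λ₁ ≤ 17/16`, `ρ < 19/50`. -/
theorem tubeLipschitzRef_of_le {Λ₁ ρ : ℝ} (hΛ : Λ₁ ≤ 17 / 16) (hρ : ρ < 19 / 50) : TubeLipschitzRef Λ₁ ρ :=
  tubeLipschitzRef_of_pairModulusRef (pairModulusRef_of_le hΛ hρ)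

/-- ★★ 7c‴ ⟸ ITS CONVEXITY HALF: `TubeConvexityRef Λ₁ ρ → TubeConvexRef Λ₁ ρ` for `Λ₁ ≤ 17/16`, `ρ < 19/50`. -/
theorem tubeConvexRef_of_convexityRef {Λ₁ ρ : ℝ} (hΛ : Λ₁ ≤ 17 / 16) (hρ : ρ < 19 / 50) (hC : TubeConvexityRef Λ₁ ρ) :
    TubeConvexRef Λ₁ ρ :=
  tubeConvexRef_of_split (tubeLipschitzRef_of_le hΛ hρ) hC

/-! ## §2 CH-Ref: channel dominance round the references -/

/-- ★ CH-Ref · **`TubeChannelsRef Λ₁ ρ`** — channel dominance data on the `ρ`-tube round every uniformly clean zero-gap-stress stacked reference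
(`TubeConvexRef`'s binder list verbatim; the tube centres are registry increments). [CERT · INSTRUMENTABLE (TAG 176) · census objects = references] -/
def TubeChannelsRef (Λ₁ ρ : ℝ) : Prop :=
  ∀ δ : ℝ, 0 < δ → ∀ (a b : E3) (w' : ℤ → E3), IsStacked a b w' → LinearIndependent ℝ ![a, b] → ‖a‖ ≤ Λ₁ → ‖b‖ ≤ Λ₁ →
    IsSep δ (Layered a b w') → IsCleanW (μS (Layered a b w')) → (∀ m : ℤ, gapStress a b m (incr w') = 0) →
    UniformlyClean (Layered a b w') → TubeChannelData a b w' ρ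

/-- glue modulo pair moduli: `PairModulusRef Λ₁ ρ → TubeChannelsRef Λ₁ ρ → TubeConvexityRef Λ₁ ρ` (the seam `isTubeConvex_of_channels` with the
tube summability from the pair moduli). -/
theorem tubeConvexityRef_of_pairModulus_channels {Λ₁ ρ : ℝ} (hP : PairModulusRef Λ₁ ρ) (hC : TubeChannelsRef Λ₁ ρ) :
    TubeConvexityRef Λ₁ ρ := by
  intro δ hδ a b w' hst hab ha hb hs hc hz hUC
  obtain ⟨τ, hτ0, hτ3, hPM⟩ := hP δ hδ a b w' hst hab ha hb hs hc hz hUC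
  exact tubeConvexityData_of_channels (fun m _ hh => summable_famOf_tube hδ hab hst hs hτ0 hτ3 hPM m hh)
    (hC δ hδ a b w' hst hab ha hb hs hc hz hUC)

/-- ★ `TubeChannelsRef Λ₁ ρ → TubeConvexityRef Λ₁ ρ` for `Λ₁ ≤ 17/16`, `ρ < 19/50`. -/
theorem tubeConvexityRef_of_channels {Λ₁ ρ : ℝ} (hΛ : Λ₁ ≤ 17 / 16) (hρ : ρ < 19 / 50) (hC : TubeChannelsRef Λ₁ ρ) :
    TubeConvexityRef Λ₁ ρ :=
  tubeConvexityRef_of_pairModulus_channels (pairModulusRef_of_le hΛ hρ) hC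

/-- ★★ `TubeChannelsRef Λ₁ ρ → TubeConvexRef Λ₁ ρ` for `Λ₁ ≤ 17/16`, `ρ < 19/50`. -/
theorem tubeConvexRef_of_channels {Λ₁ ρ : ℝ} (hΛ : Λ₁ ≤ 17 / 16) (hρ : ρ < 19 / 50) (hC : TubeChannelsRef Λ₁ ρ) : TubeConvexRef Λ₁ ρ :=
  tubeConvexRef_of_convexityRef hΛ hρ (tubeConvexityRef_of_channels hΛ hρ hC)

/-- ★★ OF RECORD: `TubeChannelsRef (17/16) (1/40) → TubeConvexRef (17/16) (1/40)`. -/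
theorem tubeConvexRef_record_of_channels (hC : TubeChannelsRef (17 / 16) (1 / 40)) : TubeConvexRef (17 / 16) (1 / 40) :=
  tubeConvexRef_of_channels le_rfl (by norm_num) hC

/-! ## §3 The leaves in the Ref currency -/

/-- ★ LEAF CHᴬ-Ref · `AdjacentChannelRef Λ₁ ρ λ_T λ_N` — adjacent channel monotonicity with uniform constants round every reference, channels w.r.t.
any unit normal `ν ⊥ a, b`. [CERT · ONE explicit planar lattice sum on ONE ball round a registry increment] -/
def AdjacentChannelRef (Λ₁ ρ lT lN : ℝ) : Prop :=
  ∀ δ : ℝ, 0 < δ → ∀ (a b : E3) (w' : ℤ → E3), IsStacked a b w' → LinearIndependent ℝ ![a, b] → ‖a‖ ≤ Λ₁ → ‖b‖ ≤ Λ₁ →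
    IsSep δ (Layered a b w') → IsCleanW (μS (Layered a b w')) → (∀ m : ℤ, gapStress a b m (incr w') = 0) →
    UniformlyClean (Layered a b w') →
    ∀ ν : E3, ‖ν‖ = 1 → ⟪ν, a⟫ = 0 → ⟪ν, b⟫ = 0 → IsAdjacentChannelMono a b w' ρ ν lT lN

/-- ★ LEAF CHꜰ-Ref below `s₀` · `FarChannelBelowRef Λ₁ ρ μ_T μ_N s₀`. [CERT · finitely many lattice sums along span-`s` registry windows] -/
def FarChannelBelowRef (Λ₁ ρ : ℝ) (μT μN : ℕ → ℝ) (s₀ : ℕ) : Prop :=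
  ∀ δ : ℝ, 0 < δ → ∀ (a b : E3) (w' : ℤ → E3), IsStacked a b w' → LinearIndependent ℝ ![a, b] → ‖a‖ ≤ Λ₁ → ‖b‖ ≤ Λ₁ →
    IsSep δ (Layered a b w') → IsCleanW (μS (Layered a b w')) → (∀ m : ℤ, gapStress a b m (incr w') = 0) →
    UniformlyClean (Layered a b w') →
    ∀ ν : E3, ‖ν‖ = 1 → ⟪ν, a⟫ = 0 → ⟪ν, b⟫ = 0 → IsFarChannelModulusBelow a b w' ρ ν μT μN s₀

/-- ★ LEAF tail-Ref · `PairModulusTailRef Λ₁ ρ s₀ B₂` — Lipschitz span moduli with an explicit uniform tail budget from `s₀` on. [ANALYTIC] -/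
def PairModulusTailRef (Λ₁ ρ : ℝ) (s₀ : ℕ) (B₂ : ℝ) : Prop :=
  ∀ δ : ℝ, 0 < δ → ∀ (a b : E3) (w' : ℤ → E3), IsStacked a b w' → LinearIndependent ℝ ![a, b] → ‖a‖ ≤ Λ₁ → ‖b‖ ≤ Λ₁ →
    IsSep δ (Layered a b w') → IsCleanW (μS (Layered a b w')) → (∀ m : ℤ, gapStress a b m (incr w') = 0) →
    UniformlyClean (Layered a b w') →
    ∃ τ : ℕ → ℝ, (∀ s, 0 ≤ τ s) ∧ (∀ N : ℕ, ∑ s ∈ Finset.Ico s₀ N, ((s : ℕ) : ℝ) ^ 2 * τ s ≤ B₂) ∧ IsPairModulus a b w' ρ τ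

/-- ★★ glue of the Ref leaves ⇒ CH-Ref. -/
theorem tubeChannelsRef_of_leaves {Λ₁ ρ lT lN lam B₁T B₁N B₂ : ℝ} {μT μN : ℕ → ℝ} {s₀ : ℕ}
    (hA : AdjacentChannelRef Λ₁ ρ lT lN) (hB : FarChannelBelowRef Λ₁ ρ μT μN s₀) (hP : PairModulusTailRef Λ₁ ρ s₀ B₂)
    (hμT : ∀ s, 0 ≤ μT s) (hμN : ∀ s, 0 ≤ μN s)
    (h₁T : ∑ s ∈ Finset.Ico 2 s₀, ((s : ℕ) : ℝ) ^ 2 * μT s ≤ B₁T) (h₁N : ∑ s ∈ Finset.Ico 2 s₀, ((s : ℕ) : ℝ) ^ 2 * μN s ≤ B₁N)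
    (hlam : 0 < lam) (hlamT : lam + (B₁T + B₂) ≤ lT) (hlamN : lam + (B₁N + B₂) ≤ lN) : TubeChannelsRef Λ₁ ρ := by
  intro δ hδ a b w' hst hab ha hb hs hc hz hUC
  obtain ⟨ν, hν, hνa, hνb⟩ := exists_unit_normal hab
  obtain ⟨τ, hτ0, hτB, hPM⟩ := hP δ hδ a b w' hst hab ha hb hs hc hz hUC
  exact tubeChannelData_of_certs hν (hA δ hδ a b w' hst hab ha hb hs hc hz hUC ν hν hνa hνb)
    (hB δ hδ a b w' hst hab ha hb hs hc hz hUC ν hν hνa hνb) hPM hμT hμN hτ0 h₁T h₁N hτB hlam hlamT hlamN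

/-- ★ 7c‴ of record from the Ref LEAVES at `(Λ₁, ρ) = (17/16, 1/40)`. -/
theorem tubeConvexRef_record_of_leaves {lT lN lam B₁T B₁N B₂ : ℝ} {μT μN : ℕ → ℝ} {s₀ : ℕ}
    (hA : AdjacentChannelRef (17 / 16) (1 / 40) lT lN) (hB : FarChannelBelowRef (17 / 16) (1 / 40) μT μN s₀)
    (hP : PairModulusTailRef (17 / 16) (1 / 40) s₀ B₂) (hμT : ∀ s, 0 ≤ μT s) (hμN : ∀ s, 0 ≤ μN s)
    (h₁T : ∑ s ∈ Finset.Ico 2 s₀, ((s : ℕ) : ℝ) ^ 2 * μT s ≤ B₁T) (h₁N : ∑ s ∈ Finset.Ico 2 s₀, ((s : ℕ) : ℝ) ^ 2 * μN s ≤ B₁N)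
    (hlam : 0 < lam) (hlamT : lam + (B₁T + B₂) ≤ lT) (hlamN : lam + (B₁N + B₂) ≤ lN) : TubeConvexRef (17 / 16) (1 / 40) :=
  tubeConvexRef_record_of_channels (tubeChannelsRef_of_leaves hA hB hP hμT hμN h₁T h₁N hlam hlamT hlamN)

/-! ## §4 The RDEF cones with slot 7 in the Ref currency -/

section Record

open Summit.AtomisticToContinuum.Crystallization.Theses.OverbindingBudget (RobustDefectLimitWindows)
open Summit.AtomisticToContinuum.Crystallization.Theses.PricedLinkCensus (ChargedEnergyGap)
open Summit.AtomisticToContinuum.Crystallization.Theorems.OverbindingBudgetGradedBareness (CleanlessExcessT)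
open Summit.AtomisticToContinuum.Crystallization.Theorems.OverbindingBudgetCoherentCut (CoherentResidual)
open Summit.AtomisticToContinuum.Crystallization.Theorems.OverbindingBudgetUniformCutStatements (GrossCleanBallsU)
open Summit.AtomisticToContinuum.Crystallization.Theorems.OverbindingBudgetElasticSplitScale (CompressedVirialLaw)
open Summit.AtomisticToContinuum.Crystallization.Theorems.OverbindingBudgetScaleWidening (DoorPeriodicW)
open Summit.AtomisticToContinuum.Crystallization.Theorems.OverbindingBudgetTwoShellShape (TwoShellShape BarlowGluingW)
open Summit.AtomisticToContinuum.Crystallization.Theorems.OverbindingBudgetStackedRigidityW (StackedReductionW GapStressVanishesW)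
open Summit.AtomisticToContinuum.Crystallization.Theorems.OverbindingBudgetStackedRigidityRef (RegistryPinningW BasalReferenceCW)
open Summit.AtomisticToContinuum.Crystallization.Theorems.ChartedPlanarOrderTubeConvex (rdef_of_grossU_shape_gluing_pinning_convexRef)

/-- ★ **RDEF cone `…_pinning_convexityRef`**: lens-4's reference-centred cone `…_pinning_convexRef` ((s), via `…_pinning_uniqRef`) with slot 7 fed by
the CONVEXITY HALF 7c‴ᶜ `TubeConvexityRef Λ₁ ρ₀` only (`Λ₁ ≤ 17/16`, `ρ₀ < 19/50`); the reference slot is `BasalReferenceCW Λ₁ ρ₁`. -/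
theorem rdef_of_grossU_shape_gluing_pinning_convexityRef (Λ Λ₁ ρ₀ ρ₁ : ℝ) (hΛ₁ : Λ₁ ≤ 17 / 16) (hρ₀ : ρ₀ < 19 / 50)
    (hG : GrossCleanBallsU (1 / 250) 10) (hCEG : ChargedEnergyGap) (hC : CompressedVirialLaw (1 / 250) 10)
    (hS : TwoShellShape (1 / 100) (3 / 50) (1 / 450)) (hB₂ : BarlowGluingW) (hD : DoorPeriodicW Λ) (hSR : StackedReductionW Λ Λ₁)
    (hV : GapStressVanishesW Λ₁) (hP : RegistryPinningW Λ₁ ρ₀ ρ₁) (hT : TubeConvexityRef Λ₁ ρ₀) (hRef : BasalReferenceCW Λ₁ ρ₁)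
    (hCE : CleanlessExcessT) (hRes : CoherentResidual 10) : RobustDefectLimitWindows :=
  rdef_of_grossU_shape_gluing_pinning_convexRef Λ Λ₁ ρ₀ ρ₁ hG hCEG hC hS hB₂ hD hSR hV hP (tubeConvexRef_of_convexityRef hΛ₁ hρ₀ hT)
    hRef hCE hRes

/-- ★ **RDEF cone `…_pinning_channelsRef`**: slot 7 = CH-Ref `TubeChannelsRef Λ₁ ρ₀`. -/
theorem rdef_of_grossU_shape_gluing_pinning_channelsRef (Λ Λ₁ ρ₀ ρ₁ : ℝ) (hΛ₁ : Λ₁ ≤ 17 / 16) (hρ₀ : ρ₀ < 19 / 50)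
    (hG : GrossCleanBallsU (1 / 250) 10) (hCEG : ChargedEnergyGap) (hC : CompressedVirialLaw (1 / 250) 10)
    (hS : TwoShellShape (1 / 100) (3 / 50) (1 / 450)) (hB₂ : BarlowGluingW) (hD : DoorPeriodicW Λ) (hSR : StackedReductionW Λ Λ₁)
    (hV : GapStressVanishesW Λ₁) (hP : RegistryPinningW Λ₁ ρ₀ ρ₁) (hT : TubeChannelsRef Λ₁ ρ₀) (hRef : BasalReferenceCW Λ₁ ρ₁)
    (hCE : CleanlessExcessT) (hRes : CoherentResidual 10) : RobustDefectLimitWindows :=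
  rdef_of_grossU_shape_gluing_pinning_convexityRef Λ Λ₁ ρ₀ ρ₁ hΛ₁ hρ₀ hG hCEG hC hS hB₂ hD hSR hV hP
    (tubeConvexityRef_of_channels hΛ₁ hρ₀ hT) hRef hCE hRes

/-- the Ref-currency cone at `(Λ, Λ₁; ρ₀, ρ₁) = (2, 17/16; 1/40, 3/16)` with slot 7 = 7c‴ᶜ. -/
theorem rdef_of_grossU_shape_gluing_pinning_convexityRef_record (hG : GrossCleanBallsU (1 / 250) 10) (hCEG : ChargedEnergyGap)
    (hC : CompressedVirialLaw (1 / 250) 10) (hS : TwoShellShape (1 / 100) (3 / 50) (1 / 450)) (hB₂ : BarlowGluingW) (hD : DoorPeriodicW 2)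
    (hSR : StackedReductionW 2 (17 / 16)) (hV : GapStressVanishesW (17 / 16)) (hP : RegistryPinningW (17 / 16) (1 / 40) (3 / 16))
    (hT : TubeConvexityRef (17 / 16) (1 / 40)) (hRef : BasalReferenceCW (17 / 16) (3 / 16)) (hCE : CleanlessExcessT)
    (hRes : CoherentResidual 10) : RobustDefectLimitWindows :=
  rdef_of_grossU_shape_gluing_pinning_convexityRef 2 (17 / 16) (1 / 40) (3 / 16) le_rfl (by norm_num) hG hCEG hC hS hB₂ hD hSR hV hP hT
    hRef hCE hRes

/-- the Ref-currency cone at `(2, 17/16; 1/40, 3/16)` with slot 7 = CH-Ref. -/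
theorem rdef_of_grossU_shape_gluing_pinning_channelsRef_record (hG : GrossCleanBallsU (1 / 250) 10) (hCEG : ChargedEnergyGap)
    (hC : CompressedVirialLaw (1 / 250) 10) (hS : TwoShellShape (1 / 100) (3 / 50) (1 / 450)) (hB₂ : BarlowGluingW) (hD : DoorPeriodicW 2)
    (hSR : StackedReductionW 2 (17 / 16)) (hV : GapStressVanishesW (17 / 16)) (hP : RegistryPinningW (17 / 16) (1 / 40) (3 / 16))
    (hT : TubeChannelsRef (17 / 16) (1 / 40)) (hRef : BasalReferenceCW (17 / 16) (3 / 16)) (hCE : CleanlessExcessT)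
    (hRes : CoherentResidual 10) : RobustDefectLimitWindows :=
  rdef_of_grossU_shape_gluing_pinning_channelsRef 2 (17 / 16) (1 / 40) (3 / 16) le_rfl (by norm_num) hG hCEG hC hS hB₂ hD hSR hV hP hT hRef
    hCE hRes

end Record

end Summit.AtomisticToContinuum.Crystallization.Theorems.ChartedPlanarOrderTubeChannelsRef
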